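import Mathlib

/-!
# IsogenyTransport — the elementary steps of T4-B4 «B3 Application (ii)» (the non-primitive vertex)

Sub-claim B4 (route/T4-B4-p1.md, owner p1), B3 Application (ii), builds the fourth threefold
`A_4 = E_1^3` of the bridge from the standard threefold `A_{T_4}` through an `F_0`-equivariant
isogeny `φ : A_{T_4} → E_1^3` of exponent `e`, with quasi-inverse `ψ` (Lange Prop. 1.1.15:
`ψ ∘ φ = e`, `φ ∘ ψ = e`), and TRANSPORTS the `F`-action: `ι_4(x) := e⁻¹ · φ ∘ ι(x) ∘ ψ`.
Three elementary facts are used there and are kernel-checked here, in the linear-algebra model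
of rational homology (`End⁰(A) ↪ End_ℚ(H_1(A, ℚ))`, so homomorphisms are `ℚ`-linear maps and
the isogeny relations are identities of linear maps):

* `transportAlgHom` — `ι_4` is a `ℚ`-algebra homomorphism `F → End(A_4)` («`ι_4(x)ι_4(y) =
  (1/e²) φ ι(x) ψ φ ι(y) ψ = (1/e) φ ι(x) ι(y) ψ = ι_4(xy)`; `ι_4(1) = (1/e) φψ = 1`»), and
  `transportAlgHom_comp` — it intertwines: `φ ∘ ι(x) = ι_4(x) ∘ φ`.
* `diagonal_restrict_eq_scalar` — for `x ∈ F_0` the analytic representation `diag(σ(x))_{σ ∈ T_4}`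
  of `ι(x)` on `A_{T_4}` is the scalar `ψ_0(x)`, because every `σ ∈ T_4` restricts to `ψ_0` on `F_0`
  (so the transported `F_0`-action on `A_4` is the tautological one).
* `eq_zero_of_forall_mul_conj_eq` / `eq_zero_of_forall_isIntegral_mul_conj_eq` — «a homomorphism
  `E_1 → E_1` with analytic representation `z ↦ az` satisfies `a ȳ = y a` for all `y ∈ O_{F_0′}` only
  if `a = 0`»: the non-existence of a non-zero `F_0′`-equivariant map for the vertex `010`
  (ref-4 R4-B4-3), for every non-real embedding of a number field.

Nothing about abelian varieties, tori or isogenies themselves is formalised (T4-B4 GAPS).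
-/

namespace Summit.Ventures.HodgeRepro2

section Transport

variable {R : Type*} [Field R] {M M' : Type*} [AddCommGroup M] [Module R M] [AddCommGroup M']
  [Module R M'] {F : Type*} [Ring F] [Algebra R F]

/-- The transported action `ι_4(x) := e⁻¹ • (φ ∘ ι(x) ∘ ψ)` of T4-B4 B3 Application (ii). -/
noncomputable def transportAction (ι : F →ₐ[R] Module.End R M) (φ : M →ₗ[R] M') (ψ : M' →ₗ[R] M)
    (e : R) (x : F) : Module.End R M' :=
  e⁻¹ • (φ ∘ₗ ι x ∘ₗ ψ)

/-- `transportAction`, pointwise. -/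
theorem transportAction_apply (ι : F →ₐ[R] Module.End R M) (φ : M →ₗ[R] M') (ψ : M' →ₗ[R] M)
    (e : R) (x : F) (v : M') : transportAction ι φ ψ e x v = e⁻¹ • φ (ι x (ψ v)) := rfl

variable (ι : F →ₐ[R] Module.End R M) (φ : M →ₗ[R] M') (ψ : M' →ₗ[R] M) (e : R)

/-- The quasi-inverse relation `ψ ∘ φ = e`, pointwise. -/
theorem comp_apply_eq_smul_of_comp_eq (h : ψ ∘ₗ φ = e • LinearMap.id) (v : M) :
    ψ (φ v) = e • v := by
  have := LinearMap.congr_fun h v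
  simpa using this

/-- The quasi-inverse relation `φ ∘ ψ = e`, pointwise. -/
theorem comp_apply_eq_smul_of_comp_eq' (h : φ ∘ₗ ψ = e • LinearMap.id) (v : M') :
    φ (ψ v) = e • v := by
  have := LinearMap.congr_fun h v
  simpa using this

/-- `ι_4(1) = (1/e) φψ = 1`. -/
theorem transportAction_one (hφψ : φ ∘ₗ ψ = e • LinearMap.id) (he : e ≠ 0) :
    transportAction ι φ ψ e 1 = 1 := by
  ext v
  rw [transportAction_apply, map_one, Module.End.one_apply, comp_apply_eq_smul_of_comp_eq' φ ψ e hφψ,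
    smul_smul, inv_mul_cancel₀ he, one_smul, Module.End.one_apply]

/-- `ι_4(x)ι_4(y) = (1/e²) φ ι(x) ψ φ ι(y) ψ = (1/e) φ ι(x) ι(y) ψ = ι_4(xy)`. -/
theorem transportAction_mul (hψφ : ψ ∘ₗ φ = e • LinearMap.id) (he : e ≠ 0) (x y : F) :
    transportAction ι φ ψ e (x * y) = transportAction ι φ ψ e x * transportAction ι φ ψ e y := by
  ext v
  simp only [Module.End.mul_apply, transportAction_apply, map_smul,
    comp_apply_eq_smul_of_comp_eq φ ψ e hψφ, smul_smul, map_mul]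
  congr 1
  field_simp

/-- `ι_4` is additive. -/
theorem transportAction_add (x y : F) :
    transportAction ι φ ψ e (x + y) = transportAction ι φ ψ e x + transportAction ι φ ψ e y := by
  ext v
  rw [LinearMap.add_apply, transportAction_apply, transportAction_apply, transportAction_apply,
    map_add, LinearMap.add_apply, map_add, smul_add]

/-- `ι_4(0) = 0`. -/
theorem transportAction_zero : transportAction ι φ ψ e 0 = 0 := by
  ext v
  rw [transportAction_apply, map_zero, LinearMap.zero_apply, map_zero, smul_zero,
    LinearMap.zero_apply]

/-- `ι_4` is `R`-linear: `ι_4(r • 1) = r • 1` (`ι_4(r) = (1/e) φ (r·id) ψ = r·(1/e) φψ = r`). -/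
theorem transportAction_algebraMap (hφψ : φ ∘ₗ ψ = e • LinearMap.id) (he : e ≠ 0) (r : R) :
    transportAction ι φ ψ e (algebraMap R F r) = algebraMap R (Module.End R M') r := by
  ext v
  rw [transportAction_apply, AlgHom.commutes, Module.algebraMap_end_eq_smul_id, LinearMap.smul_apply,
    LinearMap.id_apply, map_smul, comp_apply_eq_smul_of_comp_eq' φ ψ e hφψ, smul_smul, smul_smul,
    mul_comm e⁻¹ r, mul_assoc, inv_mul_cancel₀ he, mul_one, Module.algebraMap_end_eq_smul_id,
    LinearMap.smul_apply, LinearMap.id_apply]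

/-- THE TRANSPORTED ACTION `ι_4 : F → End(A_4)` is an `R`-algebra homomorphism (T4-B4 B3
Application (ii): «`ι_4` is a `ℚ`-algebra homomorphism»). -/
noncomputable def transportAlgHom (hψφ : ψ ∘ₗ φ = e • LinearMap.id)
    (hφψ : φ ∘ₗ ψ = e • LinearMap.id) (he : e ≠ 0) : F →ₐ[R] Module.End R M' where
  toFun := transportAction ι φ ψ e
  map_one' := transportAction_one ι φ ψ e hφψ he
  map_mul' := transportAction_mul ι φ ψ e hψφ he
  map_zero' := transportAction_zero ι φ ψ e
  map_add' := transportAction_add ι φ ψ e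
  commutes' := transportAction_algebraMap ι φ ψ e hφψ he

/-- `transportAlgHom`, unfolded. -/
theorem transportAlgHom_apply (hψφ : ψ ∘ₗ φ = e • LinearMap.id) (hφψ : φ ∘ₗ ψ = e • LinearMap.id)
    (he : e ≠ 0) (x : F) : transportAlgHom ι φ ψ e hψφ hφψ he x = e⁻¹ • (φ ∘ₗ ι x ∘ₗ ψ) := rfl

/-- THE INTERTWINING `φ ∘ ι(x) = ι_4(x) ∘ φ` (so the analytic representation of `ι_4(x)` is
conjugate to that of `ι(x)` by `φ`, and `(A_4, ι_4)` has the CM type of `(A_{T_4}, ι)`). -/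
theorem transportAlgHom_comp (hψφ : ψ ∘ₗ φ = e • LinearMap.id) (hφψ : φ ∘ₗ ψ = e • LinearMap.id)
    (he : e ≠ 0) (x : F) :
    transportAlgHom ι φ ψ e hψφ hφψ he x ∘ₗ φ = φ ∘ₗ ι x := by
  ext v
  rw [LinearMap.comp_apply, transportAlgHom_apply, LinearMap.smul_apply, LinearMap.comp_apply,
    LinearMap.comp_apply, comp_apply_eq_smul_of_comp_eq φ ψ e hψφ, map_smul, map_smul, smul_smul,
    inv_mul_cancel₀ he, one_smul, LinearMap.comp_apply]

/-- Likewise `ψ ∘ ι_4(x) = ι(x) ∘ ψ`. -/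
theorem comp_transportAlgHom (hψφ : ψ ∘ₗ φ = e • LinearMap.id) (hφψ : φ ∘ₗ ψ = e • LinearMap.id)
    (he : e ≠ 0) (x : F) :
    ψ ∘ₗ transportAlgHom ι φ ψ e hψφ hφψ he x = ι x ∘ₗ ψ := by
  ext v
  rw [LinearMap.comp_apply, transportAlgHom_apply, LinearMap.smul_apply, LinearMap.comp_apply,
    LinearMap.comp_apply, map_smul, comp_apply_eq_smul_of_comp_eq φ ψ e hψφ, smul_smul,
    inv_mul_cancel₀ he, one_smul]

end Transport

section Scalar

variable {F₀ F : Type*} [Field F₀] [Field F] [Algebra F₀ F]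

/-- For `x ∈ F_0` every `σ ∈ T_4` takes the same value `ψ_0(x)`, because `T_4` is induced from
`ψ_0`: the analytic representation `(σ(x))_{σ ∈ T_4}` of `ι(x)` is the constant vector `ψ_0(x)`. -/
theorem restrict_eq_of_comp_eq (T : Set (F →+* ℂ)) (ψ₀ : F₀ →+* ℂ)
    (hT : ∀ σ ∈ T, σ.comp (algebraMap F₀ F) = ψ₀) (x₀ : F₀) :
    (fun σ : T => (σ : F →+* ℂ) (algebraMap F₀ F x₀)) = fun _ => ψ₀ x₀ := by
  funext σ
  exact RingHom.congr_fun (hT σ σ.2) x₀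

/-- The same as a matrix identity: `diag(σ(x))_{σ ∈ T_4} = ψ_0(x) · 1` («for `x ∈ F_0`,
`ι(x) = ψ_0(x)·1` on `A_{T_4}`», T4-B4 B3 Application (ii)). -/
theorem diagonal_restrict_eq_scalar (T : Set (F →+* ℂ)) [Fintype T] [DecidableEq T]
    (ψ₀ : F₀ →+* ℂ) (hT : ∀ σ ∈ T, σ.comp (algebraMap F₀ F) = ψ₀) (x₀ : F₀) :
    Matrix.diagonal (fun σ : T => (σ : F →+* ℂ) (algebraMap F₀ F x₀)) =
      Matrix.scalar T (ψ₀ x₀) := by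
  rw [restrict_eq_of_comp_eq T ψ₀ hT x₀, Matrix.scalar_apply]

end Scalar

section NonEquivariance

/-- «`a ȳ = y a` for all `y` in a set containing a non-real number only if `a = 0`»: there is no
non-zero `ℂ`-linear map intertwining the conjugate structure with the tautological one. -/
theorem eq_zero_of_forall_mul_conj_eq {S : Set ℂ} (hS : ∃ y ∈ S, starRingEnd ℂ y ≠ y) (a : ℂ)
    (h : ∀ y ∈ S, a * starRingEnd ℂ y = y * a) : a = 0 := by
  obtain ⟨y, hy, hne⟩ := hS
  have h2 : a * (starRingEnd ℂ y - y) = 0 := by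
    rw [mul_sub, h y hy, mul_comm, sub_self]
  rcases mul_eq_zero.1 h2 with h3 | h3
  · exact h3
  · exact absurd (sub_eq_zero.1 h3) hne

/-- A non-real embedding `τ : K → ℂ` of a field takes a non-real value somewhere. -/
theorem exists_conj_ne_of_not_isReal {K : Type*} [Field K] (τ : K →+* ℂ)
    (hτ : ¬ NumberField.ComplexEmbedding.IsReal τ) : ∃ y : K, starRingEnd ℂ (τ y) ≠ τ y := by
  by_contra hcon
  apply hτ
  rw [NumberField.ComplexEmbedding.isReal_iff]
  ext y
  rw [NumberField.ComplexEmbedding.conjugate_coe_eq]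
  by_contra hne
  exact hcon ⟨y, hne⟩

/-- The non-real value can be taken at an algebraic integer (`exists_integral_multiples`). -/
theorem exists_isIntegral_conj_ne_of_not_isReal {K : Type*} [Field K] [NumberField K]
    (τ : K →+* ℂ) (hτ : ¬ NumberField.ComplexEmbedding.IsReal τ) :
    ∃ y : K, IsIntegral ℤ y ∧ starRingEnd ℂ (τ y) ≠ τ y := by
  obtain ⟨y, hy⟩ := exists_conj_ne_of_not_isReal τ hτ
  obtain ⟨n, hn, hint⟩ := exists_integral_multiples ℤ ℚ ({y} : Finset K)
  refine ⟨n • y, hint y (Finset.mem_singleton_self y), ?_⟩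
  intro heq
  apply hy
  rw [map_zsmul, map_zsmul] at heq
  exact smul_right_injective ℂ hn heq

/-- THE NON-EQUIVARIANCE of T4-B4 B3 Application (ii) (ref-4 R4-B4-3): for a non-real embedding
`τ` of a number field (e.g. `F_0′ = τ(F_0)` imaginary quadratic), a complex number `a` with
`a · conj(τ y) = τ y · a` for every algebraic integer `y` is `0` — so `Hom_{F_0′}(E_1, E_1) = 0`
when the source carries the conjugate `F_0′`-structure and the target the tautological one. -/
theorem eq_zero_of_forall_isIntegral_mul_conj_eq {K : Type*} [Field K] [NumberField K]
    (τ : K →+* ℂ) (hτ : ¬ NumberField.ComplexEmbedding.IsReal τ) (a : ℂ)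
    (h : ∀ y : K, IsIntegral ℤ y → a * starRingEnd ℂ (τ y) = τ y * a) : a = 0 := by
  obtain ⟨y, hy, hne⟩ := exists_isIntegral_conj_ne_of_not_isReal τ hτ
  refine eq_zero_of_forall_mul_conj_eq (S := τ '' {y : K | IsIntegral ℤ y}) ⟨τ y, ⟨y, hy, rfl⟩, hne⟩ a ?_
  rintro _ ⟨z, hz, rfl⟩
  exact h z hz

/-- What `p_4` does commute with: the multiplication by `a` commutes with every `O_{F_0′}`-multiplication
`[y]` taken on both sides with the same (tautological) structure — `ℂ` is commutative. -/
theorem mul_comm_of_tautological (a y : ℂ) : a * y = y * a := mul_comm a y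

end NonEquivariance

end Summit.Ventures.HodgeRepro2
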